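import Mathlib.Combinatorics.Nullstellensatz
import Mathlib.Data.Nat.Choose.Bounds
import Literature.Computability.AlgebraicComplexity.Forbes15MeasureSemicontinuity
import Literature.Computability.AlgebraicComplexity.Forbes15SmallSupportMonomials
import Literature.Computability.AlgebraicComplexity.MS21SigmaPiSigmaClosureProofs
import Literature.Computability.AlgebraicComplexity.DDS21BorderDepthThree
import HarnessLib

/-!
# Dutta–Dwivedi–Saxena 2021, Thm. 6.6: a hitting set for `\overline{Σ∧ΣΠ^{[δ]}}` — proof

Discharge BY NAME of the typed literature fact
`Literature.Computability.AlgebraicComplexity.DDS2021_thm_6_6` (`DDS21BorderDepthThree.lean`, cell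
`val-lit` row X2-DDS21): `theorem DDS2021_thm_6_6_holds : DDS2021_thm_6_6`.

Source: P. Dutta, P. Dwivedi, N. Saxena, *Demystifying the border of depth-3 algebraic circuits*,
FOCS 2021 [DuttaDwivediSaxena2022]; full version held as `paper:galaxy-pdf-7641649743695546420`,
§6.1 (p0045–p0047, printed lines 1193–1264). THE PRINTED PROOF IS FOLLOWED STEP BY STEP
("Remark 6.7. Unlike the PIT result for the border of depth 3 circuits, we obtained this result
without de-bordering the circuit at all", L1263–1264):

1. **Lemma 6.4 / Claim 6.5** (`DDS2021.exists_support_card_lt_of_mem_border_swspClass`): if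
   `g = Σ_{i<t} c_i g_i^{e_i} ∈ F(ε)[x]` (`deg g_i ≤ δ`) approximates `f ∈ F[x]` (`g = f + εQ`), then
   the trailing monomial `x^a` of `f` (lex order) has support `η < 33(δ+2)(⌊log₂ t⌋+1)`: project
   onto the variables of `x^a` ("`ρ : x_i → y_i` for `i ∈ S` and `x_i → 0` for `i ∉ S`", L1223–1224),
   bound Forbes's shifted-partials measure of `ρ(g)` from above over `F(ε)` (Lemma 6.1), pass to
   `ε = 0` by the minors argument (Claim 6.5) and bound the measure of `ρ(f)` from below by the
   trailing monomial (Prop. 6.2 / Lemma 6.3, (6.1)) — the two bounds are incompatible for large `η`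
   ([48, Lem. A.6]). All of this is the tree's Forbes-2015 kit read on the two sides of `ε → 0`:
   `Forbes15MeasureSemicontinuity.border_card_lt_of_isTrailing_linear_ratFunc`.
2. **Thm. 6.6** (L1252–1262): "Let `S ∈ C([n], η)`. Define `ρ_S` … `ρ_S(f)` is an `η`-variate
   degree-`d` polynomial, for which Lemma 2.24 gives a trivial hitting set of size `O(d^η)` … we do
   this for all such `S`, to obtain the final hitting set of size `C(n,η)·O(d^η) ≤ O((nd)^η)`."
   Here: `DDS2021.sparseGrid n η W` = all points supported on a set `T` of `≤ η` coordinates with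
   values in a grid `W ⊆ F`, `|W| > d` (`W = {0,1,…,s²} ⊆ F`, `char F = 0`); the "trivial hitting
   set" step is Mathlib's `MvPolynomial.eq_zero_of_eval_zero_at_prod_finset` applied to `ρ_T(f)`
   (`DDS2021.exists_eval_ne_zero_sparseGrid`); `|H| ≤ ((n+1)(s²+1))^η ≤ s^{4η} ≤ s^{264(δ+1)(⌊log₂ s⌋+1)}`.

Typed-vs-printed (disclosed in `DDS21BorderDepthThree.lean` and unchanged here): the typed fact
asks for the EXISTENCE of a hitting set of size `s^{c(δ+1)(log₂ s+1)}` for the border class within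
budget `s` (explicitness dropped); the set constructed here is the printed one (all
`η`-sparse grid points), so nothing beyond the typed statement is claimed. The absolute constant
`c = 264` comes from the tree's linear Forbes constant `33(δ+2)` (print: `O(δ log s)`).

No new definition of a notion, no named fact (D-0026): `DDS2021.ringKillVar` (the projection over
a coefficient RING, the tree's `Forbes15.killVar` being stated over a field) and
`DDS2021.sparseGrid` are proof plumbing with bodies. No `instance`, no notation. Honest framing:
a 2021 published PIT result for a border depth-4 class, kernel-checked in its existence form;
`VP ≠ VNP` is NOT proved and nothing here bears on it beyond the by-name discharge.

## References
* [DuttaDwivediSaxena2022] §6.1: Lemma 6.1 (L1201–1203), Prop. 6.2, Lemma 6.3, Lemma 6.4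
  (L1220–1243), Claim 6.5 (L1228–1236), Thm. 6.6 (L1248–1262), Remark 6.7; Lemma 2.24 (trivial
  hitting set for few variables).
* [Forbes2015] Prop. 6.5, Cor. 6.4, Lemma 4.13, Lemma A.6 (tree files `Forbes15*`).
-/

noncomputable section

open MvPolynomial
open Finsupp (embDomain comapDomain embDomain_comapDomain embDomain_injective embDomain_eq_mapDomain
  comapDomain_apply)

namespace Literature.Computability.AlgebraicComplexity

namespace DDS2021

/-! ### The projection `ρ_S` over a coefficient ring, and its images under `map` -/

section Projection

variable {R : Type*} [CommRing R] {ι : Type*}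

open Classical in
/-- DDS's substitution `ρ_S` ("`x_i → y_i` for `i ∈ S` and `x_i → 0` for `i ∉ S`", followed by the
renaming `S ≅ Fin |S|`) over a coefficient RING — the same formula as the tree's field-level
`Forbes15.killVar`. [cite: DuttaDwivediSaxena2022, §6.1 Lemma 6.4 (proof, full version p0046 L1223–1224)] -/
def ringKillVar (S : Finset ι) (j : ι) : MvPolynomial (Fin S.card) R :=
  if h : j ∈ S then X (S.equivFin ⟨j, h⟩) else 0

/-- `ρ_S` commutes with a change of coefficients into a field.
[cite: DuttaDwivediSaxena2022, §6.1 Claim 6.5 (proof)] -/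
theorem map_ringKillVar {E : Type*} [Field E] (χ : R →+* E) (S : Finset ι) (j : ι) :
    map χ (ringKillVar (R := R) S j) = Forbes15.killVar (F := E) S j := by
  unfold ringKillVar Forbes15.killVar
  split_ifs <;> simp

/-- `χ(ρ_S P) = ρ_S(χ P)`. [cite: DuttaDwivediSaxena2022, §6.1 Claim 6.5 (proof)] -/
theorem map_bind₁_ringKillVar {E : Type*} [Field E] (χ : R →+* E) (S : Finset ι)
    (P : MvPolynomial ι R) :
    map χ (bind₁ (ringKillVar (R := R) S) P) = aeval (Forbes15.killVar (F := E) S) (map χ P) := by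
  have h : (fun i => map χ (ringKillVar (R := R) S i)) = Forbes15.killVar (F := E) S :=
    funext (map_ringKillVar χ S)
  rw [map_bind₁, aeval_eq_bind₁, h]

end Projection

/-! ### DDS Lemma 6.4 (with Claim 6.5): the trailing monomial of an approximated `Σ∧ΣΠ^{[δ]}`
polynomial has small support -/

section SmallSupport

variable {F : Type} [Field F] [CharZero F]

omit [CharZero F] in
/-- `rename` along `Fin.castLE (h : n ≤ n)` is the identity. [folklore] -/
private theorem rename_castLE_self {n : ℕ} (h : n ≤ n) (f : MvPolynomial (Fin n) F) :
    rename (Fin.castLE h) f = f := by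
  have : (Fin.castLE h : Fin n → Fin n) = id := Fin.castLE_rfl n
  rw [this, rename_id]
  rfl

/-- Total degree is monotone in the support, across coefficient rings. [folklore] -/
private theorem totalDegree_le_of_support_subset' {R S : Type*} [CommSemiring R] [CommSemiring S]
    {σ : Type*} {p : MvPolynomial σ R} {q : MvPolynomial σ S} (h : p.support ⊆ q.support) :
    p.totalDegree ≤ q.totalDegree :=
  Finset.sup_mono h

/-- **DDS Lemma 6.4 (Trailing monomial support) for the border of `Σ∧ΣΠ^{[δ]}`.** If
`f ∈ F[x_1..x_n]` (`char F = 0`) is approximated by `g = Σ_{i<t} c_i·g_i^{e_i} ∈ Σ∧ΣΠ^{[δ]}` over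
`F(ε)` (`deg g_i ≤ δ`; the exponent bound `e` and the sparsity `m` play no role) and `f ≠ 0`, then
`f` has a monomial (its lex-trailing monomial) of support `< 33(δ+2)·(⌊log₂ t⌋+1)` (print:
`η = O(δ log s)`). Printed proof, verbatim: projection `ρ_S` onto the support `S` of `TM(f)`,
Forbes's measure upper bound over `F(ε)` (Lemma 6.1), the minors argument `ε → 0` (Claim 6.5),
the trailing-monomial lower bound over `F` ((6.1)), and [Forbes 2015, Lemma A.6].
[cite: DuttaDwivediSaxena2022, §6.1 Lemma 6.4 and Claim 6.5 (full version p0046 L1220 – p0047 L1243)] -/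
theorem exists_support_card_lt_of_mem_border_swspClass {n t e δ m : ℕ}
    {f : MvPolynomial (Fin n) F} (hf : f ∈ border (swspClass (RatFunc F) n t e δ m))
    (hf0 : f ≠ 0) :
    ∃ a ∈ f.support, a.support.card < 33 * (δ + 2) * (Nat.log 2 t + 1) := by
  classical
  -- unpack the approximation `g = f + εQ`, `g = Σ c_i g_i^{e_i}` over `F(ε)`
  obtain ⟨g, hg, hfg⟩ := hf
  obtain ⟨c, gf, ex, hgf, rfl⟩ := hg
  obtain ⟨hle, P₀, hgP, hfP⟩ := hfg.exists_eq_map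
  rw [rename_castLE_self] at hfP
  -- the lex-trailing monomial of `f` and its support `S`
  have hne : f.support.Nonempty := by
    rw [Finset.nonempty_iff_ne_empty, Ne, MvPolynomial.support_eq_empty]; exact hf0
  obtain ⟨a₀, ha₀, hmin⟩ := f.support.exists_min_image (fun m => toLex m) hne
  refine ⟨a₀, ha₀, ?_⟩
  set S := a₀.support with hS
  let emb := Forbes15.embOf S
  let ψF : MvPolynomial (Fin n) F →ₐ[F] MvPolynomial (Fin S.card) F :=
    aeval (Forbes15.killVar S)
  let ψL : MvPolynomial (Fin n) (RatFunc F) →ₐ[RatFunc F] MvPolynomial (Fin S.card) (RatFunc F) :=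
    aeval (Forbes15.killVar S)
  let r : (Fin S.card →₀ ℕ) →+ Lex (Fin n →₀ ℕ) :=
    (Forbes15.lexRank (Fin n)).comp (Finsupp.embDomain.addMonoidHom emb)
  have hr_apply : ∀ b, r b = toLex (embDomain emb b) := fun _ => rfl
  have hr : Function.Injective r := fun b₁ b₂ h => by
    rw [hr_apply, hr_apply] at h
    exact embDomain_injective emb (toLex.injective h)
  have hmono : Monotone r := fun b₁ b₂ h => by
    rw [hr_apply, hr_apply]
    refine Finsupp.toLex_monotone ?_
    rw [embDomain_eq_mapDomain, embDomain_eq_mapDomain]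
    exact Finsupp.mapDomain_mono h
  -- the trailing monomial of `ρ_S f` has full support
  set a₀' : Fin S.card →₀ ℕ := comapDomain emb a₀ emb.injective.injOn with ha₀'
  have hea : embDomain emb a₀' = a₀ :=
    embDomain_comapDomain (by rw [Forbes15.range_embOf])
  have htrail : Forbes15.IsTrailing r (ψF f) a₀' := by
    refine ⟨?_, fun b hb => ?_⟩
    · rw [Forbes15.coeff_killRename, hea]; exact MvPolynomial.mem_support_iff.mp ha₀
    · rw [MvPolynomial.mem_support_iff, Forbes15.coeff_killRename] at hb
      rw [hr_apply, hr_apply, hea]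
      exact hmin _ (MvPolynomial.mem_support_iff.mpr hb)
  have hfull : ∀ j, ((a₀' j : ℕ) : F) ≠ 0 := fun j => by
    rw [ha₀', comapDomain_apply]
    exact Nat.cast_ne_zero.mpr (Finsupp.mem_support_iff.mp (Forbes15.embOf_mem S j))
  -- the `F[ε]`-model of the projected polynomial and its two images
  set P : MvPolynomial (Fin S.card) (Polynomial F) := bind₁ (ringKillVar S) P₀ with hP
  have hPF : map Polynomial.constantCoeff P = ψF f := by
    rw [hP, map_bind₁_ringKillVar, hfP]
  have hPL : map (algebraMap (Polynomial F) (RatFunc F)) P =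
      ∑ i, C (c i) * (ψL (gf i)) ^ ex i := by
    rw [hP, map_bind₁_ringKillVar, ← hgP]
    change ψL (∑ i, C (c i) * gf i ^ ex i) = _
    rw [map_sum]
    refine Finset.sum_congr rfl fun i _ => ?_
    rw [map_mul, map_pow, algHom_C, MvPolynomial.algebraMap_eq]
  -- «ψ g is of the same form and complexity»
  have hu : ∀ i : Fin t, Forbes15.LogAffine (fun _ : Fin S.card => algebraMap F (RatFunc F) 1)
      (C (c i) : MvPolynomial (Fin S.card) (RatFunc F)) := fun i => Forbes15.LogAffine.const _ _
  have hG : ∀ i : Fin t, (ψL (gf i)).totalDegree ≤ δ := fun i =>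
    (Forbes15.totalDegree_aeval_le_of_le_one _ (Forbes15.totalDegree_killVar_le S) _).trans
      (hgf i).2.1
  have hfP' : Forbes15.IsTrailing r (map Polynomial.constantCoeff P) a₀' := by
    rw [hPF]; exact htrail
  exact Forbes15.border_card_lt_of_isTrailing_linear_ratFunc hr hmono (α := fun _ => (1 : F))
    (fun _ => one_ne_zero) P hu hG hPL hfP' hfull

omit [CharZero F] in
/-- **Degree of a border element of `Σ∧ΣΠ^{[δ]}`**: `deg f ≤ e·δ` (coefficientwise limits do not
raise degrees; `deg (c·g^{e'}) ≤ e'·deg g`). [cite: DuttaDwivediSaxena2022, §6.1 Thm. 6.6 ("n-variate, degree d polynomials approximated by `Σ∧ΣΠ^{[δ]}` circuits")] -/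
theorem totalDegree_le_of_mem_border_swspClass {n t e δ m : ℕ}
    {f : MvPolynomial (Fin n) F} (hf : f ∈ border (swspClass (RatFunc F) n t e δ m)) :
    f.totalDegree ≤ e * δ := by
  classical
  obtain ⟨g, hg, hfg⟩ := hf
  obtain ⟨c, gf, ex, hgf, rfl⟩ := hg
  obtain ⟨hle, P₀, hgP, hfP⟩ := hfg.exists_eq_map
  rw [rename_castLE_self] at hfP
  -- `deg f ≤ deg P₀ = deg g`
  have h1 : f.totalDegree ≤ P₀.totalDegree := by
    rw [← hfP]
    exact totalDegree_le_of_support_subset' (support_map_subset _ _)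
  have h2 : P₀.totalDegree ≤ (map (algebraMap (Polynomial F) (RatFunc F)) P₀).totalDegree :=
    totalDegree_le_of_support_subset'
      (support_map_of_injective _ (RatFunc.algebraMap_injective F)).symm.subset
  have h3 : (∑ i, C (c i) * gf i ^ ex i).totalDegree ≤ e * δ := by
    refine totalDegree_finsetSum_le fun i _ => ?_
    calc (C (c i) * gf i ^ ex i).totalDegree
        ≤ (C (c i)).totalDegree + (gf i ^ ex i).totalDegree := totalDegree_mul _ _
      _ ≤ 0 + ex i * (gf i).totalDegree := by
          rw [totalDegree_C]; exact add_le_add le_rfl (totalDegree_pow _ _)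
      _ ≤ e * δ := by
          rw [zero_add]; exact Nat.mul_le_mul (hgf i).1 (hgf i).2.1
  rw [hgP] at h3
  exact h1.trans (h2.trans h3)

end SmallSupport

/-! ### The sparse-support grid (DDS Thm. 6.6: `⋃_S H_S`, with Lemma 2.24 on each `S`) -/

section Grid

variable {F : Type*} [Field F] [DecidableEq F]

/-- **The hitting set of Thm. 6.6**: all points of `F^n` supported on a set `T` of at most `η`
coordinates, with values from the grid `W` on `T` (and `0` off `T`) — "with respect to `S` we get a
hitting set `H_S` … we do this for all such `S`". [cite: DuttaDwivediSaxena2022, §6.1 Thm. 6.6 (proof, full version p0047 L1256–1262)] -/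
def sparseGrid (n η : ℕ) (W : Finset F) : Finset (Fin n → F) :=
  ((Finset.univ : Finset (Fin n)).powerset.filter fun T => T.card ≤ η).biUnion
    fun T => Fintype.piFinset fun i => if i ∈ T then W else {0}

/-- The substitution killing the variables outside `T` (no renaming).
[cite: DuttaDwivediSaxena2022, §6.1 Thm. 6.6 (proof: the map `ρ_S`)] -/
private def killOutside {n : ℕ} (T : Finset (Fin n)) (i : Fin n) : MvPolynomial (Fin n) F :=
  if i ∈ T then X i else 0

omit [DecidableEq F] in
/-- Coefficients of `ρ_T f`: the monomials supported in `T` survive, the others die.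
[cite: DuttaDwivediSaxena2022, §6.1 Thm. 6.6 (proof: "monomials of support `S ⊇ support(x^a)` will survive")] -/
private theorem coeff_bind₁_killOutside {n : ℕ} (T : Finset (Fin n)) (f : MvPolynomial (Fin n) F)
    (b : Fin n →₀ ℕ) :
    coeff b (bind₁ (killOutside (F := F) T) f) = if b.support ⊆ T then coeff b f else 0 := by
  classical
  induction f using MvPolynomial.induction_on' with
  | add p q hp hq =>
    rw [map_add, coeff_add, coeff_add, hp, hq]
    split_ifs <;> simp
  | monomial d a =>
    rw [bind₁_monomial, coeff_monomial]
    by_cases hd : d.support ⊆ T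
    · have hprod : (∏ i ∈ d.support, killOutside (F := F) T i ^ d i) = monomial d 1 := by
        rw [monomial_eq, C_1, one_mul, Finsupp.prod]
        refine Finset.prod_congr rfl fun i hi => ?_
        rw [killOutside, if_pos (hd hi)]
      rw [hprod, C_mul_monomial, mul_one, coeff_monomial]
      by_cases hdb : d = b
      · subst hdb; rw [if_pos rfl, if_pos hd]
      · rw [if_neg hdb]; split_ifs <;> rfl
    · rw [Finset.not_subset] at hd
      obtain ⟨j, hjd, hjT⟩ := hd
      have hprod : (∏ i ∈ d.support, killOutside (F := F) T i ^ d i) = 0 := by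
        refine Finset.prod_eq_zero hjd ?_
        rw [killOutside, if_neg hjT, zero_pow (Finsupp.mem_support_iff.mp hjd)]
      rw [hprod, mul_zero, coeff_zero]
      split_ifs with hb hdb
      · subst hdb; exact absurd hb (fun h => hjT (h hjd))
      · rfl
      · rfl

/-- **Hitting (Thm. 6.6 with Lemma 2.24):** a polynomial of degree `≤ D < |W|` having SOME monomial
of support `≤ η` does not vanish on `sparseGrid n η W` — kill the variables outside that support
(the monomial survives), then apply the grid lemma coordinatewise.
[cite: DuttaDwivediSaxena2022, §6.1 Thm. 6.6 (proof, full version p0047 L1256–1262)] -/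
theorem exists_eval_ne_zero_sparseGrid {n η D : ℕ} {W : Finset F} (hW : D < W.card)
    {f : MvPolynomial (Fin n) F} (hdeg : f.totalDegree ≤ D) {a : Fin n →₀ ℕ}
    (ha : a ∈ f.support) (haη : a.support.card ≤ η) :
    ∃ x ∈ sparseGrid n η W, eval x f ≠ 0 := by
  classical
  set T := a.support with hT
  set Q := bind₁ (killOutside (F := F) T) f with hQ
  -- `Q ≠ 0`, `supp Q ⊆ supp f`, and `Q` only involves the variables of `T`
  have hQa : coeff a Q ≠ 0 := by
    rw [hQ, coeff_bind₁_killOutside, if_pos (subset_refl _)]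
    exact MvPolynomial.mem_support_iff.mp ha
  have hQ0 : Q ≠ 0 := fun h => hQa (by rw [h, coeff_zero])
  have hsuppQ : ∀ b ∈ Q.support, b.support ⊆ T ∧ b ∈ f.support := by
    intro b hb
    rw [MvPolynomial.mem_support_iff, hQ, coeff_bind₁_killOutside] at hb
    by_cases h : b.support ⊆ T
    · rw [if_pos h] at hb; exact ⟨h, MvPolynomial.mem_support_iff.mpr hb⟩
    · rw [if_neg h] at hb; exact absurd rfl hb
  have hQdeg : Q.totalDegree ≤ D :=
    (totalDegree_le_of_support_subset fun b hb => (hsuppQ b hb).2).trans hdeg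
  -- the coordinate grid `S i = W` on `T`, `{0}` off `T`
  set Sg : Fin n → Finset F := fun i => if i ∈ T then W else {0} with hSg
  have hdegOf : ∀ i, Q.degreeOf i < (Sg i).card := by
    intro i
    by_cases hi : i ∈ T
    · rw [hSg]; simp only [if_pos hi]
      exact ((degreeOf_le_totalDegree Q i).trans hQdeg).trans_lt hW
    · rw [hSg]; simp only [if_neg hi, Finset.card_singleton, Nat.lt_one_iff]
      rw [degreeOf_eq_sup, ← Nat.le_zero, Finset.sup_le_iff]
      intro b hb
      exact Nat.le_zero.mpr (Finsupp.notMem_support_iff.mp fun h => hi ((hsuppQ b hb).1 h))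
  -- the grid lemma: some grid point is a non-root of `Q`
  have hex : ∃ x : Fin n → F, (∀ i, x i ∈ Sg i) ∧ eval x Q ≠ 0 := by
    by_contra hcon
    push Not at hcon
    exact hQ0 (eq_zero_of_eval_zero_at_prod_finset Q Sg hdegOf hcon)
  obtain ⟨x, hxS, hxQ⟩ := hex
  -- `Q(x) = f(x)` because `x` vanishes off `T`
  have hx0 : ∀ i, i ∉ T → x i = 0 := fun i hi => by
    have := hxS i
    rw [hSg] at this; simp only [if_neg hi, Finset.mem_singleton] at this
    exact this
  have heval : eval x Q = eval x f := by
    rw [hQ]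
    change eval₂Hom (RingHom.id F) x (bind₁ _ f) = _
    rw [eval₂Hom_bind₁]
    change eval (fun i => eval x (killOutside (F := F) T i)) f = eval x f
    have hpt : (fun i => eval x (killOutside (F := F) T i)) = x := by
      funext i
      by_cases hi : i ∈ T
      · rw [killOutside, if_pos hi, eval_X]
      · rw [killOutside, if_neg hi, map_zero, hx0 i hi]
    rw [hpt]
  refine ⟨x, ?_, by rwa [← heval]⟩
  rw [sparseGrid, Finset.mem_biUnion]
  refine ⟨T, ?_, ?_⟩
  · rw [Finset.mem_filter, Finset.mem_powerset]
    exact ⟨Finset.subset_univ _, haη⟩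
  · rw [Fintype.mem_piFinset]
    exact hxS

/-- `Σ_{j ≤ η} C(n, j) ≤ (n+1)^η`. [folklore] -/
private theorem sum_choose_le_succ_pow (n : ℕ) :
    ∀ η : ℕ, ∑ j ∈ Finset.range (η + 1), n.choose j ≤ (n + 1) ^ η
  | 0 => by simp
  | η + 1 => by
    rw [Finset.sum_range_succ, pow_succ]
    have h1 := sum_choose_le_succ_pow n η
    have h2 : n.choose (η + 1) ≤ n * (n + 1) ^ η := by
      calc n.choose (η + 1) ≤ n ^ (η + 1) := Nat.choose_le_pow _ _
        _ = n * n ^ η := by ring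
        _ ≤ n * (n + 1) ^ η := Nat.mul_le_mul_left _ (Nat.pow_le_pow_left (Nat.le_succ n) η)
    nlinarith

/-- **Size of the sparse grid**: `|sparseGrid n η W| ≤ ((n+1)·|W|)^η` (for `W` nonempty;
print: `C(n,η)·O(d^η) ≤ O((nd)^η)`). [cite: DuttaDwivediSaxena2022, §6.1 Thm. 6.6 (proof, L1262)] -/
theorem card_sparseGrid_le {n η : ℕ} {W : Finset F} (hW : W.Nonempty) :
    (sparseGrid n η W).card ≤ ((n + 1) * W.card) ^ η := by
  classical
  have hW1 : 1 ≤ W.card := Finset.card_pos.mpr hW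
  -- each block has `≤ |W|^η` points
  have hblock : ∀ T ∈ ((Finset.univ : Finset (Fin n)).powerset.filter fun T => T.card ≤ η),
      (Fintype.piFinset fun i => if i ∈ T then W else ({0} : Finset F)).card ≤ W.card ^ η := by
    intro T hT
    rw [Finset.mem_filter] at hT
    rw [Fintype.card_piFinset]
    have : (∏ i, (if i ∈ T then W else ({0} : Finset F)).card) = W.card ^ T.card := by
      have h1 : (fun i : Fin n => (if i ∈ T then W else ({0} : Finset F)).card) =
          fun i => if i ∈ T then W.card else 1 := by
        funext i; split_ifs <;> simp
      rw [h1, Finset.prod_ite_mem, Finset.univ_inter, Finset.prod_const]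
    rw [this]
    exact Nat.pow_le_pow_right hW1 hT.2
  -- there are `≤ (n+1)^η` blocks
  have hcount : ((Finset.univ : Finset (Fin n)).powerset.filter fun T => T.card ≤ η).card ≤
      (n + 1) ^ η := by
    have hsub : ((Finset.univ : Finset (Fin n)).powerset.filter fun T => T.card ≤ η) ⊆
        (Finset.range (η + 1)).biUnion fun j => Finset.powersetCard j (Finset.univ : Finset (Fin n)) := by
      intro T hT
      rw [Finset.mem_filter] at hT
      rw [Finset.mem_biUnion]
      exact ⟨T.card, Finset.mem_range.mpr (Nat.lt_succ_of_le hT.2),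
        Finset.mem_powersetCard.mpr ⟨Finset.subset_univ _, rfl⟩⟩
    refine (Finset.card_le_card hsub).trans ((Finset.card_biUnion_le).trans ?_)
    have : ∀ j, (Finset.powersetCard j (Finset.univ : Finset (Fin n))).card = n.choose j := by
      intro j; rw [Finset.card_powersetCard, Finset.card_univ, Fintype.card_fin]
    simp only [this]
    exact sum_choose_le_succ_pow n η
  calc (sparseGrid n η W).card
      ≤ ∑ T ∈ ((Finset.univ : Finset (Fin n)).powerset.filter fun T => T.card ≤ η),
          (Fintype.piFinset fun i => if i ∈ T then W else ({0} : Finset F)).card :=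
        Finset.card_biUnion_le
    _ ≤ ∑ _T ∈ ((Finset.univ : Finset (Fin n)).powerset.filter fun T => T.card ≤ η), W.card ^ η :=
        Finset.sum_le_sum hblock
    _ = ((Finset.univ : Finset (Fin n)).powerset.filter fun T => T.card ≤ η).card * W.card ^ η := by
        rw [Finset.sum_const, smul_eq_mul]
    _ ≤ (n + 1) ^ η * W.card ^ η := Nat.mul_le_mul_right _ hcount
    _ = ((n + 1) * W.card) ^ η := by rw [mul_pow]

end Grid

end DDS2021

/-! ### Thm. 6.6 by name -/

open DDS2021 HittingSets

/-- Arithmetic of the size bound: for `s ≥ 2`, `n ≤ s`, `η ≤ 33(δ+2)(⌊log₂ s⌋+1)`: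
`((n+1)(s²+1+0))^η ≤ s^{264(δ+1)(⌊log₂ s⌋+1)}`. [cite: DuttaDwivediSaxena2022, §6.1 Thm. 6.6 ("s^{O(δ log s)}")] -/
private theorem size_bound {n s δ η : ℕ} (hs : 2 ≤ s) (hn : n ≤ s)
    (hη : η ≤ 33 * (δ + 2) * (Nat.log 2 s + 1)) :
    ((n + 1) * (s * s + 1)) ^ η ≤ s ^ (264 * (δ + 1) * (Nat.log 2 s + 1)) := by
  have h1 : (n + 1) * (s * s + 1) ≤ s ^ 4 := by
    have : (n + 1) * (s * s + 1) ≤ (s + 1) * (s * s + 1) :=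
      Nat.mul_le_mul_right _ (Nat.succ_le_succ hn)
    refine this.trans ?_
    have hs2 : s * s ≥ 2 * s := Nat.mul_le_mul_right s hs
    nlinarith
  calc ((n + 1) * (s * s + 1)) ^ η ≤ (s ^ 4) ^ η := Nat.pow_le_pow_left h1 η
    _ = s ^ (4 * η) := by rw [← pow_mul]
    _ ≤ s ^ (264 * (δ + 1) * (Nat.log 2 s + 1)) := by
        refine Nat.pow_le_pow_right (by omega) ?_
        calc 4 * η ≤ 4 * (33 * (δ + 2) * (Nat.log 2 s + 1)) := Nat.mul_le_mul_left 4 hη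
          _ ≤ 264 * (δ + 1) * (Nat.log 2 s + 1) := by nlinarith

/-- **DDS Thm. 6.6 (hitting set for `\overline{Σ∧ΣΠ^{[δ]}}`) — the named fact `DDS2021_thm_6_6`
DISCHARGED, by the printed route of §6.1** (Lemma 6.4 / Claim 6.5: small support of the trailing
monomial of a border element via Forbes's measure on both sides of `ε → 0`; then the sparse grid
`⋃_{|T| ≤ η} H_T`). Constant `c = 264`; grid values `{0, 1, …, s²} ⊆ F` (`char F = 0`).
Typed weaker than print (explicitness dropped in `DDS2021_thm_6_6`): printed route, explicit grid,
cost model not typed — the set `DDS2021.sparseGrid` is the printed `⋃_S H_S`, but no running-time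
statement is made (the tree has no cost model for points of `F^n` over an abstract field).
[cite: DuttaDwivediSaxena2022, Thm. 6.6 (full version p0047, L1248–1262)] -/
theorem DDS2021_thm_6_6_holds : DDS2021_thm_6_6 := by
  classical
  refine ⟨264, ?_⟩
  intro F _ _ n δ s hδ hn hs
  -- the grid `W = {0, …, s²}` and the sparse grid with `η = 33(δ+2)(⌊log₂ s⌋+1)`
  set W : Finset F := (Finset.range (s * s + 1)).image (Nat.cast : ℕ → F) with hW
  have hWcard : W.card = s * s + 1 := by
    rw [hW, Finset.card_image_of_injective _ Nat.cast_injective, Finset.card_range]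
  have hWne : W.Nonempty := by
    rw [← Finset.card_pos, hWcard]; exact Nat.succ_pos _
  set η := 33 * (δ + 2) * (Nat.log 2 s + 1) with hη
  refine ⟨sparseGrid n η W, ?_, ?_⟩
  · -- size
    refine (card_sparseGrid_le hWne).trans ?_
    rw [hWcard]
    exact size_bound hs hn le_rfl
  · -- hitting
    rintro f ⟨t, e, m, ht, he, hm, hf⟩ hf0
    obtain ⟨a, ha, hcard⟩ := exists_support_card_lt_of_mem_border_swspClass hf hf0
    have haη : a.support.card ≤ η := by
      refine hcard.le.trans ?_
      rw [hη]
      exact Nat.mul_le_mul_left _ (Nat.succ_le_succ (Nat.log_mono_right ht))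
    have hdeg : f.totalDegree ≤ s * s :=
      (totalDegree_le_of_mem_border_swspClass hf).trans (Nat.mul_le_mul he hδ)
    have hWlt : s * s < W.card := by rw [hWcard]; exact Nat.lt_succ_self _
    obtain ⟨x, hx, hxf⟩ := exists_eval_ne_zero_sparseGrid hWlt hdeg ha haη
    exact ⟨x, Finset.mem_coe.mpr hx, hxf⟩

end Literature.Computability.AlgebraicComplexity

end
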